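import Literature.AnabelianGeometry.EtaleTheta.TemperedRigidityValuation
import Literature.AnabelianGeometry.EtaleTheta.Discharge.Sec1Prop15Schema
import Literature.AnabelianGeometry.EtaleTheta.ContH1ConjAction
import HarnessLib

/-!
# [EtTh] Thm. 1.6 (ii)/(iii) as typed (`ThetaSetting.Thm16ii`, `Thm16iii`): SCHEMATA over the Kummer /
# valuation / étale-theta data — kernel truth table at the identity (FACT-LIST rows F-0586, F-0587)

Mochizuki, *The étale theta function …*, Publ. RIMS **45** (2009) [EtTh], §1, Thm. 1.6 (ii)/(iii), PRIMS PDF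
pp. 24–25 (printed 250–251) [cite: MochizukiEtTh2009, Thm 1.6 p.24]: (ii) "`γ` induces an isomorphism
`H¹(G_{K̈α}, (Δ_Θ)α) →̃ H¹(G_{K̈β}, (Δ_Θ)β)` that preserves both the kernel of these surjections and the
elements `1 ∈ Ẑ`"; (iii) "The isomorphism of cohomology groups induced by `γ` maps the classes
`O^×_{K̈α} · η̈^Θ_α` … to some `Π^tp_{Xβ}/Π^tp_{Yβ} ≅ Z`-conjugate of the corresponding classes `O^×_{K̈β} · η̈^Θ_β`".

PROOF-ONLY file (abc-iut cell, block F fact-proving wave, seat abc-iut-f-114 floating on the unseated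
batch-2 tranche 139; FACT-LIST rows **F-0586** `Literature.AnabelianGeometry.EtaleTheta.ThetaSetting.Thm16ii`
and **F-0587** `….ThetaSetting.Thm16iii`, trunk `TemperedRigidity.lean` (abc-iut-L2-t1), both
kernel_closedness = parametrised). No definition, no instance, no new named fact; the trunk file,
`TemperedRigidityValuation.lean` (L2-t1's soundness note on F-0586: `thm16ii_refl`, `not_thm16ii_refl_of_ne`,
`transport_refl`), `Discharge/Sec1Prop15Schema.lean` (abc-iut-f-117) and `SettingModelKummerDataEmpty.lean`
(abc-iut-w5-d171) are imported, never edited.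

Both rows are predicates on an isomorphism `γ : Π^tp_{Xα} →̃ Π^tp_{Xβ}` AND on free interface data: the
Kummer data `Eα`, `Eβ` (abstract injections `(K̈^×)^∧ ↪ H¹`), valuation data `Vα`, `Vβ` (the kernel
`Ker((K̈^×)^∧ ↠ Ẑ)`, pinned only on `K̈^×`), étale-theta data (the class `η̈^Θ`, field `etaDd`, tied to nothing).
Rule R5 of the FACT-LIST: a universal closure over such parameters is not a fact. Kernel truth table AT
THE IDENTITY `γ = id` (where the theta companion and the cohomology transport are forced to be the
identity, `transport_refl`):

* **F-0586 (ii), exact form at `γ = id`** — `thm16ii_refl_iff`: with the same Kummer datum on both sides,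
  `Thm16ii id … E E V V' ↔ V.unitsHat = V'.unitsHat` (clause (a) forces `δ = id`); hence
  `forall_valuationHatData_thm16ii_refl_iff`. The closure over the valuation parameters is therefore FALSE
  exactly when two valuation data differ, and such a pair EXISTS as soon as `(K̈^×)^∧` has an OFF-LATTICE
  element `z` (`z ≠ 1`, no nonzero power of `z` in `K̈^×` — in the genuine `(K̈^×)^∧ ≅ O^×_{K̈} × Ẑ` take
  `z = ϖ^x`, `x ∈ Ẑ ∖ ℚ`): `exists_valuationHatData_ne_of_offLattice` (the datum `O^×·⟨z⟩`),
  `not_forall_thm16ii_refl_of_offLattice`, and the fully quantified `not_forall_thm16ii_of_offLattice`.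
* **F-0587 (iii), exact form at `γ = id`** — `thm16iii_refl_iff`: `Thm16iii id … Eα Eβ ↔ ∃ σ,
  O^×·η̈_α = conj_σ(O^×·η̈_β)`; it HOLDS for `Eα = Eβ` (`thm16iii_refl_self`, `σ = 1`) and forces
  `1 ∈ O^×·η̈_α ↔ 1 ∈ O^×·η̈_β` (`Thm16iii.one_mem_thetaClasses_iff_of_refl`: `conj_σ` fixes `1`). Over ANY Kummer
  datum `K`, the pair `η̈_α := x ∉ κ(O^×_{K̈})`, `η̈_β := 1` VIOLATES it
  (`KummerData.exists_etaleThetaData_not_thm16iii_refl`); EXACT REDUCTION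
  `forall_thm16iii_refl_iff : (∀ Eα Eβ, Thm16iii id … Eα Eβ hC) ↔ ∀ K, κ(O^×_{K̈}) = ⊤` ("every class of
  `H¹(Π^tp_Ÿ, Δ_Θ)` is a unit Kummer class" — degenerate); under the origin guard this is INCOMPATIBLE with
  the consumers' standing hypothesis Prop. 1.5 (iii) for any datum (`not_forall_thm16iii_refl_of_prop15iii`,
  via abc-iut-f-117's `etaDd_not_mem_kumUnitsYdd_of_prop15iii`), whence the guarded global form
  `not_forall_thm16iii_of_exists_prop15iii`.
* **root model** — at `ThetaSetting.model p` both schemata hold for all data VACUOUSLY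
  (`model_forall_thm16ii`, `model_forall_thm16iii`; `ThetaSetting.model_isEmpty_kummerData`, abc-iut-w5-d171);
  no theta setting carrying Kummer data exists in the tree, so no unguarded `¬ ∀` is available.

DISPOSITION (R5): both rows are SCHEMATA, consumable AT NAMED INSTANCES / as hypotheses; their
conditional closers from printed inputs are abc-iut-L6-d5's `Thm16Sub.thm16ii_of_inputs`
(⇐ `TransportPreservesFdd2` = Prop. 1.5 (ii) + [SemiAnbd] Thm. 6.12, and `DeltaPreservesUnitsAndOne` =
[AbsAnab] Prop. 1.2.1 (iv)(vi)(vii)) and `Thm16Sub.thm16iii_of_core` (⇐ units transported to units,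
`Z`-stability of the unit classes, the core identity via the canonical integral structure at the cusps,
[SemiAnbd] Thm. 6.5 (iii)/Cor. 6.11) in `Thm16SubdagTransport.lean`. HONEST FRAMING: statements about OUR
typed predicates over abstract interface data; the printed Thm. 1.6 is a theorem about tempered fundamental
groups of once-punctured elliptic curves and is neither asserted nor denied; typed ≠ proved; no side is
taken on [IUTchIII] Cor. 3.12 or on any author.
-/

noncomputable section

namespace Literature.AnabelianGeometry.EtaleTheta

open Literature.AnabelianGeometry.SemiGraphs

namespace ThetaSetting

variable {p : ℕ} [Fact p.Prime] {D : ThetaSetting p}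

/-! ### F-0586: Thm. 1.6 (ii) at the identity -/

/-- **Thm. 1.6 (ii) at `γ = id`, EXACT FORM**: with the same Kummer datum on both sides, the typed (ii)
holds iff the two valuation data have the same kernel `Ker((K̈^×)^∧ ↠ Ẑ)` (clause (a) forces `δ = id` —
inflation and the Kummer map are injective — and clause (b) is then `V = V'`; clause (c) is automatic).
[cite: MochizukiEtTh2009, Thm 1.6 (ii) p.24] -/
theorem thm16ii_refl_iff (E : D.KummerData) (V V' : ValuationHatData D E) :
    Thm16ii (ContinuousMulEquiv.refl D.PiTemp) (thm16i_refl D) E E V V' ↔ V.unitsHat = V'.unitsHat := by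
  refine ⟨fun h => ?_, fun hVV' => ?_⟩
  · by_contra hne
    exact not_thm16ii_refl_of_ne E hne h
  · refine ⟨ThetaCompanion.ofRefl D, MulEquiv.refl _, fun a => ?_, ?_, fun ϖ hϖ => ⟨ϖ, hϖ, ?_⟩⟩
    · rw [transport_refl]; rfl
    · rw [← hVV']; exact Subgroup.map_id _
    · rw [MulEquiv.refl_apply, mul_inv_cancel]
      exact V'.unitsHat.one_mem

/-- Hence the closure over the valuation PARAMETERS at `γ = id` holds iff all valuation data over `E` have
the same kernel. [cite: MochizukiEtTh2009, Thm 1.6 (ii) p.24] -/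
theorem forall_valuationHatData_thm16ii_refl_iff (E : D.KummerData) :
    (∀ V V' : ValuationHatData D E, Thm16ii (ContinuousMulEquiv.refl D.PiTemp) (thm16i_refl D) E E V V') ↔
      ∀ V V' : ValuationHatData D E, V.unitsHat = V'.unitsHat :=
  forall_congr' fun V => forall_congr' fun V' => thm16ii_refl_iff E V V'

/-- **Two distinct valuation data from an off-lattice element.** If `(K̈^×)^∧` contains `z ≠ 1` none of
whose powers `z^k ≠ 1` lies in `K̈^×` (in the genuine `(K̈^×)^∧ ≅ O^×_{K̈} × Ẑ`: `z = ϖ^x` with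
`x ∈ Ẑ ∖ ℚ`), then besides the canonical kernel `O^×_{K̈}` (`ValuationHatData.canonical`) also
`O^×_{K̈} · ⟨z⟩` satisfies the only typed constraint `K̈^× ∩ Ker = O^×_{K̈}` — so the PARAMETER `V` of the
typed Thm. 1.6 (ii) is not determined by the interface. [cite: MochizukiEtTh2009, Thm 1.6 (ii) p.24] -/
theorem exists_valuationHatData_ne_of_offLattice (E : D.KummerData) {z : E.KddHat} (hz1 : z ≠ 1)
    (hz : ∀ k : ℤ, z ^ k ∈ Set.range E.toKddHat → z ^ k = 1) :
    ∃ V V' : ValuationHatData D E, V.unitsHat ≠ V'.unitsHat := by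
  refine ⟨ValuationHatData.canonical E,
    { unitsHat := D.unitsOKdd.map E.toKddHat ⊔ Subgroup.zpowers z
      mem_unitsHat_iff := fun a => ⟨fun ha => ?_, fun ha => Subgroup.mem_sup_left ⟨a, ha, rfl⟩⟩ }, ?_⟩
  · -- `toKddHat a = toKddHat b · z^k` with `b` a unit forces `z^k ∈ K̈^×`, hence `z^k = 1`, `a = b`
    obtain ⟨y, ⟨b, hb, rfl⟩, w, hw, hyw⟩ := Subgroup.mem_sup.mp ha
    obtain ⟨k, rfl⟩ := Subgroup.mem_zpowers_iff.mp hw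
    have hk : z ^ k = E.toKddHat (b⁻¹ * a) := by
      rw [map_mul, map_inv, ← hyw, inv_mul_cancel_left]
    have hk1 : z ^ k = 1 := hz k ⟨b⁻¹ * a, hk.symm⟩
    rw [hk1, mul_one] at hyw
    rwa [← E.toKddHat_injective hyw]
  · intro hV
    have hzmem : z ∈ D.unitsOKdd.map E.toKddHat ⊔ Subgroup.zpowers z :=
      Subgroup.mem_sup_right (Subgroup.mem_zpowers z)
    change (ValuationHatData.canonical E).unitsHat = D.unitsOKdd.map E.toKddHat ⊔ Subgroup.zpowers z at hV
    rw [← hV, ValuationHatData.canonical_unitsHat] at hzmem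
    obtain ⟨b, -, hb⟩ := hzmem
    have h1 := hz 1 ⟨b, by rw [zpow_one]; exact hb⟩
    rw [zpow_one] at h1
    exact hz1 h1

/-- **F-0586, relative countermodel**: over a Kummer datum whose `(K̈^×)^∧` has an off-lattice element,
the closure of the typed Thm. 1.6 (ii) over its valuation parameters FAILS already at `γ = id`.
[cite: MochizukiEtTh2009, Thm 1.6 (ii) p.24] -/
theorem not_forall_thm16ii_refl_of_offLattice (E : D.KummerData) {z : E.KddHat} (hz1 : z ≠ 1)
    (hz : ∀ k : ℤ, z ^ k ∈ Set.range E.toKddHat → z ^ k = 1) :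
    ¬ ∀ V V' : ValuationHatData D E,
        Thm16ii (ContinuousMulEquiv.refl D.PiTemp) (thm16i_refl D) E E V V' := by
  rw [forall_valuationHatData_thm16ii_refl_iff]
  intro h
  obtain ⟨V, V', hne⟩ := exists_valuationHatData_ne_of_offLattice E hz1 hz
  exact hne (h V V')

/-- **F-0586, R5 verdict (guarded)**: if SOME theta setting carries a Kummer datum with an off-lattice
element of `(K̈^×)^∧`, the universal closure of the schema `Thm16ii` (over `γ`, `h`, the Kummer and the
valuation data) is FALSE. (No theta setting with Kummer data exists in the tree: at the root model
`KummerData` is empty, `model_forall_thm16ii`.) [cite: MochizukiEtTh2009, Thm 1.6 (ii) p.24] -/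
theorem not_forall_thm16ii_of_offLattice
    (hex : ∃ (D : ThetaSetting p) (E : D.KummerData) (z : E.KddHat),
      z ≠ 1 ∧ ∀ k : ℤ, z ^ k ∈ Set.range E.toKddHat → z ^ k = 1) :
    ¬ ∀ (Dα Dβ : ThetaSetting p) (γ : Dα.PiTemp ≃ₜ* Dβ.PiTemp) (h : Thm16i γ) (Eα : Dα.KummerData)
        (Eβ : Dβ.KummerData) (Vα : ValuationHatData Dα Eα) (Vβ : ValuationHatData Dβ Eβ),
        Thm16ii γ h Eα Eβ Vα Vβ := by
  obtain ⟨D, E, z, hz1, hz⟩ := hex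
  intro h
  exact not_forall_thm16ii_refl_of_offLattice E hz1 hz fun V V' => h D D _ _ E E V V'

/-- **Root-model vacuity for F-0586**: over `ThetaSetting.model p` the typed Thm. 1.6 (ii) holds for ALL
parameters, vacuously (`KummerData` is empty there, abc-iut-w5-d171). [cite: MochizukiEtTh2009, Thm 1.6 (ii) p.24] -/
theorem model_forall_thm16ii (p : ℕ) [Fact p.Prime] :
    ∀ (γ : (ThetaSetting.model p).PiTemp ≃ₜ* (ThetaSetting.model p).PiTemp) (h : Thm16i γ)
      (Eα Eβ : (ThetaSetting.model p).KummerData) (Vα : ValuationHatData _ Eα)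
      (Vβ : ValuationHatData _ Eβ), Thm16ii γ h Eα Eβ Vα Vβ :=
  fun _ _ Eα => ((ThetaSetting.model_isEmpty_kummerData p).false Eα).elim

/-! ### F-0587: Thm. 1.6 (iii) at the identity -/

section Thm16iii

/-- Transport along the identity fixes every set of classes. [cite: MochizukiEtTh2009, Thm 1.6 (iii) p.24] -/
theorem image_transport_refl (c : ThetaCompanion (ContinuousMulEquiv.refl D.PiTemp))
    (h : Thm16i (ContinuousMulEquiv.refl D.PiTemp)) (S : Set (D.H1 D.GtpYdd)) : transport c h '' S = S := by
  ext y
  constructor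
  · rintro ⟨x, hx, rfl⟩
    rwa [transport_refl]
  · intro hy
    exact ⟨y, hy, transport_refl c h y⟩

/-- **Thm. 1.6 (iii) at `γ = id`, EXACT FORM**: the typed (iii) says that the theta classes of `Eα` are a
`Π^tp_X`-conjugate of those of `Eβ`. [cite: MochizukiEtTh2009, Thm 1.6 (iii) p.24] -/
theorem thm16iii_refl_iff (hC : D.Compat) (c : ThetaCompanion (ContinuousMulEquiv.refl D.PiTemp))
    (h : Thm16i (ContinuousMulEquiv.refl D.PiTemp)) (Eα Eβ : D.EtaleThetaData) :
    Thm16iii (ContinuousMulEquiv.refl D.PiTemp) h c Eα Eβ hC ↔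
      haveI := hC.GtpYdd_normal
      ∃ σ : D.PiTemp, Eα.thetaClasses = ContH1.conj D.toTheta D.DeltaTheta σ '' Eβ.thetaClasses := by
  haveI := hC.GtpYdd_normal
  unfold Thm16iii
  rw [image_transport_refl]

/-- **Instance form**: Thm. 1.6 (iii) HOLDS at `γ = id` with the same étale-theta datum on both sides
(`σ = 1`). [cite: MochizukiEtTh2009, Thm 1.6 (iii) p.24] -/
theorem thm16iii_refl_self (hC : D.Compat) (c : ThetaCompanion (ContinuousMulEquiv.refl D.PiTemp))
    (h : Thm16i (ContinuousMulEquiv.refl D.PiTemp)) (E : D.EtaleThetaData) :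
    Thm16iii (ContinuousMulEquiv.refl D.PiTemp) h c E E hC := by
  haveI := hC.GtpYdd_normal
  rw [thm16iii_refl_iff]
  refine ⟨1, Set.ext fun y => ⟨fun hy => ⟨y, hy, ContH1.conj_one_apply y⟩, ?_⟩⟩
  rintro ⟨x, hx, rfl⟩
  rwa [ContH1.conj_one_apply]

/-- **A necessary condition at `γ = id`**: conjugation fixes the trivial class, so (iii) forces
`1 ∈ O^×·η̈^Θ_α ↔ 1 ∈ O^×·η̈^Θ_β`, i.e. `η̈^Θ_α` is a unit Kummer class iff `η̈^Θ_β` is.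
[cite: MochizukiEtTh2009, Thm 1.6 (iii) p.24] -/
theorem Thm16iii.one_mem_thetaClasses_iff_of_refl (hC : D.Compat) (c : ThetaCompanion (ContinuousMulEquiv.refl D.PiTemp))
    (h : Thm16i (ContinuousMulEquiv.refl D.PiTemp)) {Eα Eβ : D.EtaleThetaData}
    (H : Thm16iii (ContinuousMulEquiv.refl D.PiTemp) h c Eα Eβ hC) :
    (1 : D.H1 D.GtpYdd) ∈ Eα.thetaClasses ↔ (1 : D.H1 D.GtpYdd) ∈ Eβ.thetaClasses := by
  haveI := hC.GtpYdd_normal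
  rw [thm16iii_refl_iff] at H
  obtain ⟨σ, hσ⟩ := H
  rw [hσ]
  constructor
  · rintro ⟨y, hy, hy1⟩
    have : y = 1 := (ContH1.conj_bijective σ).1 (by rw [hy1, map_one])
    rwa [this] at hy
  · intro h1
    exact ⟨1, h1, map_one _⟩

/-- An étale-theta datum over a given Kummer datum with a PRESCRIBED class `η̈^Θ := x` (all abstract
`½`-groups `ℤ`, connecting maps trivial — the field `etaDd` is tied to nothing in the interface).
[cite: MochizukiEtTh2009, Prop 1.3 p.20] -/
theorem KummerData.exists_etaleThetaData_etaDd_eq (K : D.KummerData) (x : D.H1 D.GtpYdd) :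
    ∃ E : D.EtaleThetaData, E.toKummerData = K ∧ E.etaDd = x :=
  ⟨{ toKummerData := K
     etaDd := x
     H1YhalfN := fun _ => Multiplicative ℤ
     etaN := fun _ => 1
     kumN := fun _ => 1
     H1Yhalf := Multiplicative ℤ
     eta := 1
     toLevel := fun _ => 1
     kumHalf := 1
     ofIntegralY := 1
     H1YddHalf := Multiplicative ℤ
     resHalf := 1
     ofIntegral := 1
     resHalf_ofIntegralY := fun _ => rfl
     H1ZddN := fun _ => Multiplicative ℤ
     resZN := fun _ => 1 }, rfl, rfl⟩

/-- **F-0587, relative countermodel**: over ANY Kummer datum `K` and any class `x ∉ κ(O^×_{K̈})`, the pair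
(`η̈^Θ_α := x`, `η̈^Θ_β := 1`) VIOLATES the typed Thm. 1.6 (iii) at `γ = id` (`1 ∈ O^×·1` but `1 ∉ O^×·x`).
[cite: MochizukiEtTh2009, Thm 1.6 (iii) p.24] -/
theorem KummerData.exists_etaleThetaData_not_thm16iii_refl (hC : D.Compat) (c : ThetaCompanion (ContinuousMulEquiv.refl D.PiTemp))
    (h : Thm16i (ContinuousMulEquiv.refl D.PiTemp)) (K : D.KummerData) {x : D.H1 D.GtpYdd}
    (hx : x ∉ K.kumUnitsYdd) :
    ∃ Eα Eβ : D.EtaleThetaData, Eα.toKummerData = K ∧ Eβ.toKummerData = K ∧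
      ¬ Thm16iii (ContinuousMulEquiv.refl D.PiTemp) h c Eα Eβ hC := by
  obtain ⟨Eα, hαK, hαx⟩ := K.exists_etaleThetaData_etaDd_eq x
  obtain ⟨Eβ, hβK, hβ1⟩ := K.exists_etaleThetaData_etaDd_eq 1
  refine ⟨Eα, Eβ, hαK, hβK, fun H => hx ?_⟩
  have h1β : (1 : D.H1 D.GtpYdd) ∈ Eβ.thetaClasses := ⟨1, one_mem _, by rw [hβ1, mul_one]⟩
  have h1α := (Thm16iii.one_mem_thetaClasses_iff_of_refl hC c h H).mpr h1β
  have hmem := (Eα.one_mem_thetaClasses_iff).mp h1α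
  rw [hαx] at hmem
  rw [← hαK]
  exact hmem

/-- **F-0587, exact reduction at `γ = id`**: the closure of the typed Thm. 1.6 (iii) over the étale-theta
data holds iff over EVERY Kummer datum every class of `H¹(Π^tp_Ÿ, Δ_Θ)` is a unit Kummer class
(`κ(O^×_{K̈}) = ⊤` — then all sets of theta classes are the whole group). [cite: MochizukiEtTh2009, Thm 1.6 (iii) p.24] -/
theorem forall_thm16iii_refl_iff (hC : D.Compat) (c : ThetaCompanion (ContinuousMulEquiv.refl D.PiTemp))
    (h : Thm16i (ContinuousMulEquiv.refl D.PiTemp)) :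
    (∀ Eα Eβ : D.EtaleThetaData, Thm16iii (ContinuousMulEquiv.refl D.PiTemp) h c Eα Eβ hC) ↔
      ∀ K : D.KummerData, K.kumUnitsYdd = ⊤ := by
  haveI := hC.GtpYdd_normal
  refine ⟨fun H K => ?_, fun H Eα Eβ => ?_⟩
  · rw [Subgroup.eq_top_iff']
    intro x
    by_contra hx
    obtain ⟨Eα, Eβ, -, -, hne⟩ := K.exists_etaleThetaData_not_thm16iii_refl hC c h hx
    exact hne (H Eα Eβ)
  · have huniv : ∀ E : D.EtaleThetaData, E.thetaClasses = Set.univ := fun E =>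
      Set.eq_univ_of_forall fun y => ⟨y * E.etaDd⁻¹, by rw [H]; trivial, by rw [inv_mul_cancel_right]⟩
    rw [thm16iii_refl_iff]
    refine ⟨1, ?_⟩
    rw [huniv Eα, huniv Eβ, Set.image_univ_of_surjective (ContH1.conj_bijective (1 : D.PiTemp)).2]

/-- **F-0587 versus the consumers' standing hypothesis**: under the origin guard, if SOME étale-theta datum
over `D` satisfies Prop. 1.5 (iii) as typed (its `η̈^Θ` is then NOT a unit Kummer class, abc-iut-f-117),
the closure of the typed Thm. 1.6 (iii) over the étale-theta data FAILS at `γ = id`.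
[cite: MochizukiEtTh2009, Thm 1.6 (iii) p.24] -/
theorem not_forall_thm16iii_refl_of_prop15iii (hC : D.Compat) (c : ThetaCompanion (ContinuousMulEquiv.refl D.PiTemp))
    (h : Thm16i (ContinuousMulEquiv.refl D.PiTemp)) (hO : D.IsEtThOrigin) (E : D.EtaleThetaData)
    (h15 : Prop15iii E hC) :
    ¬ ∀ Eα Eβ : D.EtaleThetaData, Thm16iii (ContinuousMulEquiv.refl D.PiTemp) h c Eα Eβ hC := by
  intro H
  obtain ⟨Eα, Eβ, -, -, hne⟩ := E.toKummerData.exists_etaleThetaData_not_thm16iii_refl hC c h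
    (E.etaDd_not_mem_kumUnitsYdd_of_prop15iii hC hO h15)
  exact hne (H Eα Eβ)

end Thm16iii

/-- **F-0587, R5 verdict (guarded)**: if SOME theta setting satisfying the origin guard carries an
étale-theta datum with Prop. 1.5 (iii) as typed, the universal closure of the schema `Thm16iii` (over `γ`,
`h`, the companion, both étale-theta data and `Compat`) is FALSE. (No such setting exists in the tree: at
the root model `EtaleThetaData` is empty, `model_forall_thm16iii`.) [cite: MochizukiEtTh2009, Thm 1.6 (iii) p.24] -/
theorem not_forall_thm16iii_of_exists_prop15iii
    (hex : ∃ (D : ThetaSetting p) (hC : D.Compat) (E : D.EtaleThetaData), D.IsEtThOrigin ∧ Prop15iii E hC) :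
    ¬ ∀ (Dα Dβ : ThetaSetting p) (γ : Dα.PiTemp ≃ₜ* Dβ.PiTemp) (h : Thm16i γ) (c : ThetaCompanion γ)
        (Eα : Dα.EtaleThetaData) (Eβ : Dβ.EtaleThetaData) (hCβ : Dβ.Compat),
        Thm16iii γ h c Eα Eβ hCβ := by
  obtain ⟨D, hC, E, hO, h15⟩ := hex
  intro H
  exact not_forall_thm16iii_refl_of_prop15iii hC (ThetaCompanion.ofRefl D) (thm16i_refl D) hO E h15
    fun Eα Eβ => H D D _ _ _ Eα Eβ hC

/-- **Root-model vacuity for F-0587**: over `ThetaSetting.model p` the typed Thm. 1.6 (iii) holds for ALL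
parameters, vacuously (`EtaleThetaData` is empty there, abc-iut-w5-d171). [cite: MochizukiEtTh2009, Thm 1.6 (iii) p.24] -/
theorem model_forall_thm16iii (p : ℕ) [Fact p.Prime] :
    ∀ (γ : (ThetaSetting.model p).PiTemp ≃ₜ* (ThetaSetting.model p).PiTemp) (h : Thm16i γ)
      (c : ThetaCompanion γ) (Eα Eβ : (ThetaSetting.model p).EtaleThetaData)
      (hC : (ThetaSetting.model p).Compat), Thm16iii γ h c Eα Eβ hC :=
  fun _ _ _ Eα => ((ThetaSetting.model_isEmpty_etaleThetaData p).false Eα).elim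

end ThetaSetting

end Literature.AnabelianGeometry.EtaleTheta

end
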